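/-
Copyright (c) 2026. All rights reserved.
Released under Apache 2.0 license as described in the file LICENSE.
-/
import Literature.NumberTheory.ComplexMultiplication.DegenerateCMTypesElementaryAbelianTwoGroup
import HarnessLib

/-!
# CM types meeting every coset of a subgroup in exactly half: the subgroups `H ∌ ρ` with all cosets balanced are
# those whose index-`2` overgroups avoiding `ρ` are balanced — Weil type over a CM subfield is Weil type over its
# imaginary quadratic subfields (group level, exponent `2`)

SETTING (tree `CMTypeRank`, `CMTypeRankCharacters`, `DegenerateCMTypesAbelianKernels`, `DegenerateCMTypesElementaryAbelianTwoGroup`).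
`G` a finite commutative group of EXPONENT `2` (the Galois group of a multiquadratic CM field), `ρ ∈ G` the complex
conjugation, `T ⊆ G` a CM type w.r.t. `ρ` (`IsCMTypeWith ρ T`: `G = T ⊔ ρT`), `H ≤ G` a subgroup.  For `x ∈ G` the
coset `xH = {t : x·t ∈ H}` (exponent `2`), and `N_H(x) = #(T ∩ xH)`.  We say the cosets of `H` are BALANCED when
`2·N_H(x) = |H|` for every `x`.  On a multiquadratic CM field `K` with `H = Gal(K/L)`: the cosets of `H` are the fibres of
`Hom(K, ℂ) → Hom(L, ℂ)` and «cosets balanced» is «the CM type has equal multiplicities `n_σ = n_σ̄ = [K:L]/2` over every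
embedding `σ` of `L`» — B. Moonen, Yu. Zarhin [MoonenZarhin1998WeilClasses], Criterion answering their Q1: the space of Weil
classes `W_L = ⋀_L^{[K:L]} H¹(A, ℚ)` of an abelian variety `A` with `L ↪ End⁰(A)` consists of Hodge classes iff
`n_σ = n_σ̄` for all `σ ∈ Σ_L` (Weil [Weil1977] for `L` imaginary quadratic); the index-`2` subgroups `H' ∌ ρ` are the
`Gal(K/F)`, `F` imaginary quadratic (tree `MultiquadraticCMFieldWalshValuesQuadraticSubfields`: odd characters ↔
hyperplanes avoiding `ρ` ↔ imaginary quadratic subfields, `Ŝ_T(χ) = #(T ∩ ker χ) − #(T ∖ ker χ)`).  THIS FILE proves,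
at the group level:

> **Theorem** (`two_mul_card_filter_mul_mem_eq`, ★).  Let `ρ ∉ H`.  If every subgroup `H' ⊇ H` of index `2` with
> `ρ ∉ H'` satisfies `2·#(T ∩ H') = |H'|`, then EVERY coset of `H` is balanced: `2·#(T ∩ xH) = |H|` for all `x`.
> **Theorem** (`two_mul_card_filter_mul_mem_eq_of_le`).  Conversely balanced cosets of `H` give balanced cosets of every
> overgroup `H' ⊇ H` (double counting; no hypothesis on `ρ`).  Hence (`forall_coset_iff_forall_indexTwo`) for `ρ ∉ H`:
> **the cosets of `H` are balanced iff every index-`2` overgroup of `H` avoiding `ρ` is balanced**, and in character form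
> (`forall_coset_iff_forall_oddChar`, any `H`): **iff `Ŝ_T(χ) = Σ_{t∈T} χ(t) = 0` for every ODD character `χ`
> (`χ(ρ) = −1`) trivial on `H`** (Kubota's vanishing characters [Kubota1965] §4 Lemma 2; if `ρ ∈ H` both sides hold).
> **Theorem** (index `4`: `eq_or_eq_of_inf_le`, `exists_eq_inf_of_index_eq_four`).  For index-`2` subgroups `H₁ ≠ H₂`
> avoiding `ρ`, `H₁ ⊓ H₂` has index `4`, avoids `ρ`, and its index-`2` overgroups avoiding `ρ` are exactly `H₁` and `H₂`
> (the third one, `{g : g ∈ H₁ ↔ g ∈ H₂}`, contains `ρ`); every index-`4` subgroup avoiding `ρ` arises so.  Hence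
> (`forall_coset_inf_iff`) the cosets of `H₁ ⊓ H₂` are balanced iff `H₁` and `H₂` are balanced — on the field side: a CM
> type is of Weil type over a biquadratic CM subfield `F₁F₂` iff it is of Weil type over both imaginary quadratic
> subfields `F₁`, `F₂` (B. Yanai's criterion «`a = b`» over a subfield, B. B. Gordon [Gordon1999HodgeAVSurvey] 9.4.3,
> stacked).

PROOF OF ★ (elementary, no characters).  `N_H(ρx) = |H| − N_H(x)` (`T` is a CM type) and `N_H(kx) = N_H(x)` for
`k ∈ H`.  CLAIM: `N_H(cx) + N_H(x) = |H|` for every `c ∉ H`: if `cρ ∈ H` this is the `ρ`-flip; otherwise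
`H' = H ⊔ ⟨c⟩ = H ⊔ cH` avoids `ρ`, has `|H'| = 2|H|`, inherits the hypothesis, so by induction on `|G| − |H|` its cosets
are balanced, and `N_{H'}(x) = N_H(x) + N_H(cx)`.  If some `c₁, c₂ ∉ H` have `c₁c₂ ∉ H`, the claim at `(c₁, x)`, `(c₂, x)`,
`(c₁c₂, c₂x)` gives `2N_H(x) = |H|`; otherwise `H` has index `2` (witness `ρ`) and the hypothesis applies to `H` itself.

HONEST SCOPE.  Group-level bookkeeping for the field dress (multiquadratic CM fields: Weil type over CM subfields of
higher degree, their count, and the exceptional Weil classes they force — sequel files); Moonen–Zarhin print the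
criterion `n_σ = n_σ̄` (Q1) and the Remark (1) «`W_{F'}` Hodge ⟹ `W_F` Hodge for `F ⊆ F'`» (our `…_of_le`); the converse via
imaginary quadratic subfields is this file's (for exponent-`2` Galois groups).  THEOREMS ONLY: no definition, no named
fact, no instance, no `sorry`.

## References

* [MoonenZarhin1998WeilClasses] B. J. J. Moonen, Yu. G. Zarhin, *Weil classes on abelian varieties*, J. reine angew.
  Math. 496 (1998) 83–92 (held `paper:arxiv-alg-geom_9612017`, pp. 1–4): Criterion (Q1) «if `n_σ = n_σ'` for all
  `σ ∈ Σ_F` then `W_F` consists entirely of Hodge classes», Criterion (Q2) (type IV, `d = 1`, `m = 1`: the non-zero classes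
  of `W_F` are exceptional iff `F ⊄ E₀`), and Remark (1) after it («`W_{F'}` Hodge ⟹ `W_F` Hodge» for `F ⊆ F'`).
* [Kubota1965] T. Kubota, *On the field extension by complex multiplication*, Trans. AMS 118 (1965), §4 Lemma 2.
* [Gordon1999HodgeAVSurvey] B. B. Gordon, *A survey of the Hodge conjecture for abelian varieties*, 9.4.1, 9.4.3
  (Theorem [B.140] = H. Yanai, *On degenerate CM-types*, J. Number Theory 49 (1994)).
* [Dodson1984] B. Dodson, *The structure of Galois groups of CM-fields*, Trans. AMS 283 (1984), §3.1.1.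
* [MontgomeryVaughan2007] H. L. Montgomery, R. C. Vaughan, *Multiplicative Number Theory I*, §4.2 Lemma 4.2 (p. 115).

## Provenance

Lane `lit-hodgefound` (Track 2, Layer A3), seat `lit-hodgefound-p10` generation 46, row g46-#1; neighbours cited by name,
nothing restated: `CyclicCMType.AbelianKernels` (`exists_oddChar_ker`, `sum_char_eq_zero_iff_of_index_two`, USED),
`CMTypeElementaryTwoGroupOddWeights` (`character_apply_eq_one_or_of_mul_self`, USED), `CMTypeRank` (`IsCMTypeWith`).
-/

open scoped BigOperators Classical

namespace Literature.NumberTheory.ComplexMultiplication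

namespace BalancedCosets

open Literature.NumberTheory.ComplexMultiplication.CyclicCMType.AbelianKernels (exists_oddChar_ker
  sum_char_eq_zero_iff_of_index_two)

variable {G : Type*} [CommGroup G] [Fintype G] [DecidableEq G] {ρ : G} {T : Finset G}

/-! ## §0 Helpers -/

section Helpers

omit [Fintype G] [DecidableEq G] in
/-- `g·g = 1` in exponent `2`. [folklore] -/
private theorem mul_self_bc (hexp : ∀ g : G, g ^ 2 = 1) (g : G) : g * g = 1 := by
  rw [← pow_two]; exact hexp g

omit [Fintype G] [DecidableEq G] in
/-- `c·(c·g) = g` in exponent `2`. [folklore] -/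
private theorem mul_mul_self_cancel_bc (hexp : ∀ g : G, g ^ 2 = 1) (c g : G) : c * (c * g) = g := by
  rw [← mul_assoc, mul_self_bc hexp, one_mul]

omit [Fintype G] [DecidableEq G] in
/-- `ρ² = 1`. [folklore] -/
private theorem rho_mul_rho_bc (h : IsCMTypeWith ρ (T : Set G)) : ρ * ρ = 1 := by
  have := h.invol (1 : G)
  simpa [smul_eq_mul] using this

omit [Fintype G] [DecidableEq G] in
/-- `ρx ∈ T ⟺ x ∉ T`. [folklore] -/
private theorem rho_mul_mem_iff_bc (h : IsCMTypeWith ρ (T : Set G)) (x : G) : ρ * x ∈ T ↔ x ∉ T := by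
  have := h.rho_smul_mem_iff x
  simpa only [smul_eq_mul, Finset.mem_coe] using this

/-- `G ∖ T = ρT`. [folklore] -/
private theorem compl_eq_image_bc (h : IsCMTypeWith ρ (T : Set G)) : Tᶜ = T.image fun s => ρ * s := by
  ext x
  rw [Finset.mem_compl, Finset.mem_image]
  constructor
  · intro hx
    refine ⟨ρ * x, (rho_mul_mem_iff_bc h x).2 hx, ?_⟩
    rw [← mul_assoc, rho_mul_rho_bc h, one_mul]
  · rintro ⟨s, hs, rfl⟩
    exact fun hx => ((rho_mul_mem_iff_bc h s).1 hx) hs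

/-- `|G| = 2|T|`. [folklore] -/
private theorem two_mul_card_bc (h : IsCMTypeWith ρ (T : Set G)) : 2 * T.card = Fintype.card G := by
  have hinj : Function.Injective fun s : G => ρ * s := fun a b hab => mul_left_cancel hab
  have h1 : Tᶜ.card = T.card := by rw [compl_eq_image_bc h, Finset.card_image_of_injective _ hinj]
  have h2 := Finset.card_add_card_compl T
  omega

omit [DecidableEq G] in
/-- `|H| = #{g : g ∈ H}` as a filter of `univ`. [folklore] -/
private theorem natCard_eq_card_filter_bc (H : Subgroup G) :
    Nat.card H = (Finset.univ.filter fun g : G => g ∈ H).card := by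
  classical
  rw [Nat.card_eq_fintype_card, ← Fintype.card_subtype]

omit [DecidableEq G] in
/-- The translate `{u : x·u ∈ H}` of `H` has `|H|` elements. [folklore] -/
private theorem card_filter_univ_mul_mem_bc (H : Subgroup G) (x : G) :
    (Finset.univ.filter fun u : G => x * u ∈ H).card = Nat.card H := by
  classical
  rw [natCard_eq_card_filter_bc]
  refine Finset.card_bij (fun u _ => x * u) (fun u hu => ?_) (fun a _ b _ hab => mul_left_cancel hab)
    (fun k hk => ⟨x⁻¹ * k, ?_, by rw [mul_inv_cancel_left]⟩)
  · simpa using hu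
  · simpa using hk

omit [DecidableEq G] in
/-- `|H'|·[H':·] ` bookkeeping: an index-`2` subgroup has `2|H'| = |G|`. [folklore] -/
private theorem two_mul_natCard_of_index_two_bc {H : Subgroup G} (hidx : H.index = 2) :
    2 * Nat.card H = Fintype.card G := by
  have := H.card_mul_index
  rw [hidx, Nat.card_eq_fintype_card (α := G)] at this
  omega

omit [Fintype G] [DecidableEq G] in
/-- `G/H` is cyclic for `H` of index `2`. [folklore] -/
private theorem isCyclic_quotient_bc {H : Subgroup G} (hidx : H.index = 2) : IsCyclic (G ⧸ H) := by
  haveI : Fact (Nat.Prime 2) := ⟨Nat.prime_two⟩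
  exact isCyclic_of_prime_card (p := 2) (by rw [← Subgroup.index_eq_card, hidx])

omit [Fintype G] [DecidableEq G] in
/-- **The kernel of an odd character is an index-`2` subgroup avoiding `ρ`** (exponent `2`: values `±1`).
[cite: MontgomeryVaughan2007, §4.2 Lemma 4.2 (p. 115)] [cite: Kubota1965, §4 Lemma 2] -/
private theorem exists_ker_bc (hexp : ∀ g : G, g ^ 2 = 1) {χ : AddChar (Additive G) ℂ}
    (hχ : χ (Additive.ofMul ρ) = -1) :
    ∃ H : Subgroup G, ρ ∉ H ∧ H.index = 2 ∧ ∀ g : G, χ (Additive.ofMul g) = 1 ↔ g ∈ H := by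
  let H : Subgroup G :=
    { carrier := {g : G | χ (Additive.ofMul g) = 1}
      one_mem' := by
        show χ (Additive.ofMul (1 : G)) = 1
        rw [ofMul_one, AddChar.map_zero_eq_one]
      mul_mem' := fun {a b} ha hb => by
        show χ (Additive.ofMul (a * b)) = 1
        have ha' : χ (Additive.ofMul a) = 1 := ha
        have hb' : χ (Additive.ofMul b) = 1 := hb
        rw [ofMul_mul, AddChar.map_add_eq_mul, ha', hb', one_mul]
      inv_mem' := fun {a} ha => by
        show χ (Additive.ofMul a⁻¹) = 1
        rwa [inv_eq_of_mul_eq_one_right (mul_self_bc hexp a)] }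
  have hmem : ∀ g : G, g ∈ H ↔ χ (Additive.ofMul g) = 1 := fun g => Iff.rfl
  have hρH : ρ ∉ H := fun h => by
    have h1 := (hmem ρ).1 h
    rw [hχ] at h1
    norm_num at h1
  refine ⟨H, hρH, ?_, fun g => (hmem g).symm⟩
  rw [Subgroup.index_eq_two_iff]
  refine ⟨ρ, fun b => ?_⟩
  rw [hmem, hmem, ofMul_mul, AddChar.map_add_eq_mul, hχ, mul_neg_one, neg_eq_iff_eq_neg, xor_def]
  rcases character_apply_eq_one_or_of_mul_self χ (mul_self_bc hexp b) with h1 | h1 <;> rw [h1] <;> norm_num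

end Helpers

/-! ## §1 The coset counts `N_H(x) = #(T ∩ xH)`: `H`-invariance, the `ρ`-flip, splitting along `H ⊔ ⟨c⟩` -/

section Counts

omit [Fintype G] [DecidableEq G] in
/-- `N_H(kx) = N_H(x)` for `k ∈ H`. [folklore] -/
private theorem card_filter_mul_mem_of_mem (H : Subgroup G) {k : G} (hk : k ∈ H) (x : G) :
    (T.filter fun t => k * x * t ∈ H).card = (T.filter fun t => x * t ∈ H).card := by
  congr 1
  refine Finset.filter_congr fun t _ => ?_
  rw [mul_assoc]
  exact ⟨fun h => by simpa using H.mul_mem (H.inv_mem hk) h, fun h => H.mul_mem hk h⟩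

/-- **The `ρ`-flip**: `N_H(ρx) + N_H(x) = |H|` — the coset `ρxH` meets `T` where `xH` meets `G ∖ T = ρT`.
[cite: Kubota1965, §4 Lemma 2 (proof)] -/
theorem card_filter_rho_mul_add (h : IsCMTypeWith ρ (T : Set G)) (H : Subgroup G) (x : G) :
    (T.filter fun t => ρ * x * t ∈ H).card + (T.filter fun t => x * t ∈ H).card = Nat.card H := by
  -- `N_H(ρx) = #{u ∈ ρT : x·u ∈ H}`
  have h1 : (T.filter fun t => ρ * x * t ∈ H).card = (Tᶜ.filter fun u => x * u ∈ H).card := by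
    rw [compl_eq_image_bc h, Finset.filter_image, Finset.card_image_of_injective _
      (fun a b hab => mul_left_cancel hab)]
    congr 1
    refine Finset.filter_congr fun t _ => ?_
    show ρ * x * t ∈ H ↔ x * (ρ * t) ∈ H
    rw [mul_assoc, mul_left_comm]
  rw [h1, ← card_filter_univ_mul_mem_bc H x]
  have h2 := Finset.card_filter_add_card_filter_not (s := Finset.univ.filter fun u : G => x * u ∈ H)
    (fun u => u ∈ T)
  have e1 : ((Finset.univ.filter fun u : G => x * u ∈ H).filter fun u => u ∈ T) = T.filter fun u => x * u ∈ H := by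
    ext u; simp only [Finset.mem_filter, Finset.mem_univ, true_and]; tauto
  have e2 : ((Finset.univ.filter fun u : G => x * u ∈ H).filter fun u => u ∉ T) =
      Tᶜ.filter fun u => x * u ∈ H := by
    ext u; simp only [Finset.mem_filter, Finset.mem_univ, true_and, Finset.mem_compl]; tauto
  rw [e1, e2] at h2
  omega

/-- If `ρ ∈ H` every coset is balanced for free (`ρxH = xH`). [cite: Kubota1965, §4 Lemma 2 (proof)] -/
theorem two_mul_card_filter_mul_mem_eq_of_mem (h : IsCMTypeWith ρ (T : Set G)) (H : Subgroup G) (hρ : ρ ∈ H)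
    (x : G) : 2 * (T.filter fun t => x * t ∈ H).card = Nat.card H := by
  have h1 := card_filter_rho_mul_add h H x
  rw [card_filter_mul_mem_of_mem H hρ x] at h1
  omega

omit [Fintype G] [DecidableEq G] in
/-- Membership in `H ⊔ ⟨c⟩` (exponent `2`): `g ∈ H ⊔ ⟨c⟩ ⟺ g ∈ H ∨ c·g ∈ H`. [folklore] -/
private theorem mem_sup_zpowers_iff_of_sq_eq_one (hexp : ∀ g : G, g ^ 2 = 1) (H : Subgroup G) (c g : G) :
    g ∈ H ⊔ Subgroup.zpowers c ↔ g ∈ H ∨ c * g ∈ H := by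
  constructor
  · intro hg
    obtain ⟨y, hy, z, hz, rfl⟩ := Subgroup.mem_sup.1 hg
    obtain ⟨k, rfl⟩ := Subgroup.mem_zpowers_iff.1 hz
    rcases Int.even_or_odd k with ⟨j, rfl⟩ | ⟨j, rfl⟩
    · left
      have : c ^ (j + j) = 1 := by
        rw [← two_mul, zpow_mul, zpow_ofNat, hexp c, one_zpow]
      rw [this, mul_one]; exact hy
    · right
      have : c ^ (2 * j + 1) = c := by
        rw [zpow_add, zpow_mul, zpow_ofNat, hexp c, one_zpow, one_mul, zpow_one]
      rw [this, mul_left_comm, mul_self_bc hexp, mul_one]; exact hy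
  · rintro (hg | hg)
    · exact Subgroup.mem_sup_left hg
    · have : g = (c * g) * c := by rw [mul_comm, mul_mul_self_cancel_bc hexp]
      rw [this]
      exact Subgroup.mul_mem _ (Subgroup.mem_sup_left hg) (Subgroup.mem_sup_right (Subgroup.mem_zpowers c))

omit [Fintype G] [DecidableEq G] in
/-- `ρ ∉ H ⊔ ⟨c⟩` when `ρ ∉ H` and `cρ ∉ H`. [folklore] -/
private theorem rho_not_mem_sup_zpowers (hexp : ∀ g : G, g ^ 2 = 1) (H : Subgroup G) {c : G} (hρ : ρ ∉ H)
    (hcρ : c * ρ ∉ H) : ρ ∉ H ⊔ Subgroup.zpowers c := by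
  rw [mem_sup_zpowers_iff_of_sq_eq_one hexp]
  tauto

omit [DecidableEq G] in
/-- `|H ⊔ ⟨c⟩| = 2|H|` for `c ∉ H` (exponent `2`: `H ⊔ ⟨c⟩ = H ⊔ cH`). [folklore] -/
private theorem natCard_sup_zpowers (hexp : ∀ g : G, g ^ 2 = 1) (H : Subgroup G) {c : G} (hc : c ∉ H) :
    Nat.card ↥(H ⊔ Subgroup.zpowers c) = 2 * Nat.card H := by
  classical
  rw [natCard_eq_card_filter_bc, natCard_eq_card_filter_bc]
  have hunion : (Finset.univ.filter fun g : G => g ∈ H ⊔ Subgroup.zpowers c) =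
      (Finset.univ.filter fun g : G => g ∈ H) ∪
        (Finset.univ.filter fun g : G => g ∈ H).image fun k => c * k := by
    ext g
    simp only [Finset.mem_filter, Finset.mem_univ, true_and, Finset.mem_union, Finset.mem_image,
      mem_sup_zpowers_iff_of_sq_eq_one hexp]
    constructor
    · rintro (hg | hg)
      · exact Or.inl hg
      · exact Or.inr ⟨c * g, hg, mul_mul_self_cancel_bc hexp c g⟩
    · rintro (hg | ⟨k, hk, rfl⟩)
      · exact Or.inl hg
      · right; rwa [mul_mul_self_cancel_bc hexp]
  have hdisj : Disjoint (Finset.univ.filter fun g : G => g ∈ H)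
      ((Finset.univ.filter fun g : G => g ∈ H).image fun k => c * k) := by
    rw [Finset.disjoint_left]
    rintro g hg hg'
    simp only [Finset.mem_filter, Finset.mem_univ, true_and, Finset.mem_image] at hg hg'
    obtain ⟨k, hk, rfl⟩ := hg'
    exact hc (by simpa using H.mul_mem hg (H.inv_mem hk))
  rw [hunion, Finset.card_union_of_disjoint hdisj,
    Finset.card_image_of_injective _ (fun a b hab => mul_left_cancel hab)]
  ring

omit [Fintype G] in
/-- **Splitting along `H ⊔ ⟨c⟩`**: `N_{H ⊔ ⟨c⟩}(x) = N_H(x) + N_H(cx)` for `c ∉ H`. [folklore] -/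
private theorem card_filter_mul_mem_sup_zpowers (hexp : ∀ g : G, g ^ 2 = 1) (H : Subgroup G) {c : G} (hc : c ∉ H)
    (x : G) :
    (T.filter fun t => x * t ∈ H ⊔ Subgroup.zpowers c).card =
      (T.filter fun t => x * t ∈ H).card + (T.filter fun t => c * x * t ∈ H).card := by
  have hor : (T.filter fun t => x * t ∈ H ⊔ Subgroup.zpowers c) =
      (T.filter fun t => x * t ∈ H) ∪ T.filter fun t => c * x * t ∈ H := by
    ext t
    simp only [Finset.mem_filter, Finset.mem_union, mem_sup_zpowers_iff_of_sq_eq_one hexp, mul_assoc]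
    tauto
  have hdisj : Disjoint (T.filter fun t => x * t ∈ H) (T.filter fun t => c * x * t ∈ H) := by
    rw [Finset.disjoint_left]
    intro t ht ht'
    rw [Finset.mem_filter] at ht ht'
    have key : c = c * x * t * (x * t)⁻¹ := by rw [mul_assoc c, mul_inv_cancel_right]
    apply hc
    rw [key]
    exact H.mul_mem ht'.2 (H.inv_mem ht.2)
  rw [hor, Finset.card_union_of_disjoint hdisj]

end Counts

/-! ## §2 ★ Index-`2` overgroups avoiding `ρ` balanced ⟹ every coset balanced -/

section Main

/-- **★ THE COSETS OF `H ∌ ρ` ARE BALANCED AS SOON AS EVERY INDEX-`2` OVERGROUP OF `H` AVOIDING `ρ` IS BALANCED.**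
On a multiquadratic CM field: a CM type which is of Weil type over every imaginary quadratic subfield of a CM subfield
`L` is of Weil type over `L` (equal multiplicities over every embedding of `L`). [cite: MoonenZarhin1998WeilClasses, Criterion (Q1) and Remark (1) after Criterion (Q2)]
[cite: Kubota1965, §4 Lemma 2] [cite: Gordon1999HodgeAVSurvey, 9.4.3] -/
theorem two_mul_card_filter_mul_mem_eq (hexp : ∀ g : G, g ^ 2 = 1) (h : IsCMTypeWith ρ (T : Set G))
    (H : Subgroup G) (hρ : ρ ∉ H)
    (hbal : ∀ H' : Subgroup G, H ≤ H' → ρ ∉ H' → H'.index = 2 →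
      2 * (T.filter fun t => t ∈ H').card = Nat.card H')
    (x : G) : 2 * (T.filter fun t => x * t ∈ H).card = Nat.card H := by
  -- strong induction on `|G| − |H|`
  suffices key : ∀ (n : ℕ) (H : Subgroup G), Fintype.card G - Nat.card H = n → ρ ∉ H →
      (∀ H' : Subgroup G, H ≤ H' → ρ ∉ H' → H'.index = 2 →
        2 * (T.filter fun t => t ∈ H').card = Nat.card H') →
      ∀ x : G, 2 * (T.filter fun t => x * t ∈ H).card = Nat.card H from key _ H rfl hρ hbal x
  intro n
  induction n using Nat.strong_induction_on with
  | _ n ih =>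
    intro H hn hρ hbal
    -- CLAIM: `N_H(c·y) + N_H(y) = |H|` for every `c ∉ H`
    have claim : ∀ c : G, c ∉ H → ∀ y : G,
        (T.filter fun t => c * y * t ∈ H).card + (T.filter fun t => y * t ∈ H).card = Nat.card H := by
      intro c hc y
      by_cases hcρ : c * ρ ∈ H
      · -- `c = (cρ)·ρ`: the `ρ`-flip
        have e : c * y = ρ * (c * ρ * y) := by
          rw [mul_left_comm, mul_assoc c ρ, mul_left_comm ρ, ← mul_assoc ρ ρ, rho_mul_rho_bc h, one_mul]
        rw [e, ← card_filter_mul_mem_of_mem H hcρ y]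
        exact card_filter_rho_mul_add h H (c * ρ * y)
      · -- go up to `H' = H ⊔ ⟨c⟩`, which avoids `ρ` and has `|H'| = 2|H|`
        set H' : Subgroup G := H ⊔ Subgroup.zpowers c with hH'
        have hρ' : ρ ∉ H' := rho_not_mem_sup_zpowers hexp H hρ hcρ
        have hcard' : Nat.card H' = 2 * Nat.card H := natCard_sup_zpowers hexp H hc
        have hle : H ≤ H' := le_sup_left
        have hHpos : 0 < Nat.card H := Nat.card_pos
        have hH'le : Nat.card H' ≤ Fintype.card G := by
          rw [← Nat.card_eq_fintype_card]; exact Nat.card_le_card_of_injective _ Subtype.val_injective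
        have hlt : Fintype.card G - Nat.card H' < n := by rw [← hn]; omega
        have hbal' : ∀ H'' : Subgroup G, H' ≤ H'' → ρ ∉ H'' → H''.index = 2 →
            2 * (T.filter fun t => t ∈ H'').card = Nat.card H'' :=
          fun H'' hle'' => hbal H'' (hle.trans hle'')
        have h1 := ih _ hlt H' rfl hρ' hbal' y
        rw [card_filter_mul_mem_sup_zpowers hexp H hc y, hcard'] at h1
        omega
    intro x
    by_cases hex : ∃ c₁ c₂ : G, c₁ ∉ H ∧ c₂ ∉ H ∧ c₁ * c₂ ∉ H
    · obtain ⟨c₁, c₂, h1, h2, h12⟩ := hex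
      have e1 := claim c₁ h1 x
      have e2 := claim c₂ h2 x
      have e3 := claim (c₁ * c₂) h12 (c₂ * x)
      have e : c₁ * c₂ * (c₂ * x) = c₁ * x := by
        rw [mul_assoc, mul_mul_self_cancel_bc hexp]
      rw [e] at e3
      omega
    · -- `H` itself has index `2` (witness `ρ`)
      push Not at hex
      have hidx : H.index = 2 := by
        rw [Subgroup.index_eq_two_iff]
        refine ⟨ρ, fun b => ?_⟩
        by_cases hb : b ∈ H
        · refine Or.inr ⟨hb, fun hbρ => hρ ?_⟩
          simpa using H.mul_mem (H.inv_mem hb) hbρ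
        · exact Or.inl ⟨hex b ρ hb hρ, hb⟩
      have h0 := hbal H le_rfl hρ hidx
      have e0 : (T.filter fun t => t ∈ H) = T.filter fun t => 1 * t ∈ H := by
        simp only [one_mul]
      rw [e0] at h0
      by_cases hx : x ∈ H
      · rw [← card_filter_mul_mem_of_mem H hx 1, mul_one] at h0
        exact h0
      · have e1 := claim x hx 1
        rw [mul_one] at e1
        omega

omit [DecidableEq G] in
/-- **Converse (upward): balanced cosets of `H` give balanced cosets of every overgroup `H' ⊇ H`** — a coset of `H'`
is a disjoint union of cosets of `H` (double counting `Σ_{y ∈ xH'} N_H(y) = |H|·N_{H'}(x)`); no hypothesis on `ρ`.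
[cite: MoonenZarhin1998WeilClasses, Remark (1) after Criterion (Q2)] -/
theorem two_mul_card_filter_mul_mem_eq_of_le (hexp : ∀ g : G, g ^ 2 = 1) {H H' : Subgroup G} (hle : H ≤ H')
    (hH : ∀ x : G, 2 * (T.filter fun t => x * t ∈ H).card = Nat.card H) (x : G) :
    2 * (T.filter fun t => x * t ∈ H').card = Nat.card H' := by
  classical
  -- `Y = {y : x·y ∈ H'}`, `|Y| = |H'|`
  set Y : Finset G := Finset.univ.filter fun y : G => x * y ∈ H' with hY
  have hYcard : Y.card = Nat.card H' := card_filter_univ_mul_mem_bc H' x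
  -- double count `Σ_{y ∈ Y} N_H(y)`
  have hsum : ∑ y ∈ Y, (T.filter fun t => y * t ∈ H).card =
      ∑ t ∈ T, (Y.filter fun y => y * t ∈ H).card := by
    simp_rw [Finset.card_filter]
    exact Finset.sum_comm
  -- for fixed `t`: `#{y ∈ Y : y·t ∈ H} = |H|·[x·t ∈ H']`
  have hfib : ∀ t : G, (Y.filter fun y => y * t ∈ H).card = if x * t ∈ H' then Nat.card H else 0 := by
    intro t
    split_ifs with hxt
    · rw [← card_filter_univ_mul_mem_bc H t]
      congr 1
      ext y
      simp only [hY, Finset.mem_filter, Finset.mem_univ, true_and]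
      constructor
      · rintro ⟨-, hy⟩; rwa [mul_comm]
      · intro hy
        refine ⟨?_, by rwa [mul_comm]⟩
        have : x * y = (x * t) * (t * y) := by
          rw [mul_assoc, ← mul_assoc t, mul_self_bc hexp, one_mul]
        rw [this]
        exact H'.mul_mem hxt (hle hy)
    · rw [Finset.card_eq_zero, Finset.filter_eq_empty_iff]
      intro y hy hyt
      simp only [hY, Finset.mem_filter, Finset.mem_univ, true_and] at hy
      apply hxt
      have : x * t = (x * y) * (y * t) := by
        rw [mul_assoc, ← mul_assoc y, mul_self_bc hexp, one_mul]
      rw [this]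
      exact H'.mul_mem hy (hle hyt)
  simp_rw [hfib] at hsum
  rw [Finset.sum_ite, Finset.sum_const_zero, add_zero, Finset.sum_const, smul_eq_mul] at hsum
  -- left side: `Σ_{y∈Y} N_H(y) = |Y|·|H|/2`
  have hleft : 2 * ∑ y ∈ Y, (T.filter fun t => y * t ∈ H).card = Y.card * Nat.card H := by
    rw [Finset.mul_sum]
    simp_rw [hH]
    rw [Finset.sum_const, smul_eq_mul]
  have hHpos : 0 < Nat.card H := Nat.card_pos
  have := congrArg (2 * ·) hsum
  rw [hleft, hYcard] at this
  -- `|H'|·|H| = 2·(N_{H'}(x)·|H|)`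
  have h3 : Nat.card H' * Nat.card H = (2 * (T.filter fun t => x * t ∈ H').card) * Nat.card H := by
    rw [this]; ring
  exact (Nat.eq_of_mul_eq_mul_right hHpos h3).symm

/-- **THE COSETS OF `H ∌ ρ` ARE BALANCED IFF EVERY INDEX-`2` OVERGROUP OF `H` AVOIDING `ρ` IS BALANCED.**
(Field side, `K` multiquadratic: a CM type is of Weil type over a CM subfield `L` iff it is of Weil type over every
imaginary quadratic subfield of `L`.) [cite: MoonenZarhin1998WeilClasses, Criterion (Q1) and Remark (1) after Criterion (Q2)]
[cite: Gordon1999HodgeAVSurvey, 9.4.3] [cite: Dodson1984, §3.1.1] -/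
theorem forall_coset_iff_forall_indexTwo (hexp : ∀ g : G, g ^ 2 = 1) (h : IsCMTypeWith ρ (T : Set G))
    (H : Subgroup G) (hρ : ρ ∉ H) :
    (∀ x : G, 2 * (T.filter fun t => x * t ∈ H).card = Nat.card H) ↔
      ∀ H' : Subgroup G, H ≤ H' → ρ ∉ H' → H'.index = 2 →
        2 * (T.filter fun t => t ∈ H').card = Nat.card H' := by
  constructor
  · intro hH H' hle _ _
    have := two_mul_card_filter_mul_mem_eq_of_le hexp hle hH 1
    simpa only [one_mul] using this
  · intro hbal x
    exact two_mul_card_filter_mul_mem_eq hexp h H hρ hbal x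

end Main

/-! ## §3 Character form: balanced cosets ⟺ the odd characters trivial on `H` vanish on `T` -/

section Characters

/-- At an index-`2` subgroup `H' ∌ ρ`: `2·#(T ∩ H') = |H'| ⟺ #(T ∩ H') = #(T ∖ H')` (`|T| = |G|/2 = |H'|`).
[cite: Dodson1984, §3.1.1] -/
theorem two_mul_card_filter_mem_eq_iff (h : IsCMTypeWith ρ (T : Set G)) {H' : Subgroup G} (hidx : H'.index = 2) :
    2 * (T.filter fun t => t ∈ H').card = Nat.card H' ↔
      (T.filter fun t => t ∈ H').card = (T.filter fun t => t ∉ H').card := by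
  have h1 := two_mul_natCard_of_index_two_bc hidx
  have h2 := two_mul_card_bc h
  have h3 := Finset.card_filter_add_card_filter_not (s := T) (fun t => t ∈ H')
  omega

/-- **CHARACTER FORM: THE COSETS OF `H` ARE BALANCED IFF `Σ_{t∈T} χ(t) = 0` FOR EVERY ODD CHARACTER `χ` TRIVIAL ON
`H`** (Kubota's vanishing odd characters, restricted to `H^⊥`; for `ρ ∈ H` both sides hold trivially).  Field side: a
CM type of a multiquadratic CM field is of Weil type over the subfield `L = K^H` iff the Walsh values `Ŝ(χ)` vanish at
all odd characters of `Gal(L/ℚ)`. [cite: Kubota1965, §4 Lemma 2] [cite: MoonenZarhin1998WeilClasses, Criterion (Q1)]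
[cite: Gordon1999HodgeAVSurvey, 9.4.1 and 9.4.3] -/
theorem forall_coset_iff_forall_oddChar (hexp : ∀ g : G, g ^ 2 = 1) (h : IsCMTypeWith ρ (T : Set G))
    (H : Subgroup G) :
    (∀ x : G, 2 * (T.filter fun t => x * t ∈ H).card = Nat.card H) ↔
      ∀ χ : AddChar (Additive G) ℂ, χ (Additive.ofMul ρ) = -1 → (∀ k ∈ H, χ (Additive.ofMul k) = 1) →
        ∑ t ∈ T, χ (Additive.ofMul t) = 0 := by
  by_cases hρ : ρ ∈ H
  · -- both sides hold
    refine ⟨fun _ χ hχ hχH => ?_, fun _ x => two_mul_card_filter_mul_mem_eq_of_mem h H hρ x⟩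
    have := hχH ρ hρ
    rw [hχ] at this
    norm_num at this
  rw [forall_coset_iff_forall_indexTwo hexp h H hρ]
  constructor
  · intro hbal χ hχ hχH
    obtain ⟨H', hρH', hidx, hker⟩ := exists_ker_bc hexp hχ
    have hle : H ≤ H' := fun k hk => (hker k).1 (hχH k hk)
    rw [sum_char_eq_zero_iff_of_index_two χ hker hidx T]
    exact (two_mul_card_filter_mem_eq_iff h hidx).1 (hbal H' hle hρH' hidx)
  · intro hχ H' hle hρH' hidx
    obtain ⟨χ, hχρ, hker⟩ := exists_oddChar_ker hρH' (rho_mul_rho_bc h) (isCyclic_quotient_bc hidx)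
    rw [two_mul_card_filter_mem_eq_iff h hidx, ← sum_char_eq_zero_iff_of_index_two χ hker hidx T]
    exact hχ χ hχρ fun k hk => (hker k).2 (hle hk)

end Characters

/-! ## §4 Index `4`: pairs of hyperplanes avoiding `ρ` (the biquadratic CM subfields `F₁F₂`) -/

section IndexFour

omit [Fintype G] [DecidableEq G] in
/-- Two distinct subgroups of index `2` are incomparable. [folklore] -/
private theorem not_le_of_index_two_bc [Finite G] {H₁ H₂ : Subgroup G} (h1 : H₁.index = 2) (h2 : H₂.index = 2)
    (hne : H₁ ≠ H₂) : ¬ H₁ ≤ H₂ := by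
  intro hle
  have hrel := Subgroup.relIndex_mul_index hle
  rw [h1, h2] at hrel
  have hr : H₁.relIndex H₂ = 1 := by omega
  exact hne (le_antisymm hle (Subgroup.relIndex_eq_one.1 hr))

omit [Fintype G] [DecidableEq G] in
/-- Two distinct subgroups of index `2`: an element of the first outside the second. [folklore] -/
private theorem exists_mem_not_mem_bc [Finite G] {H₁ H₂ : Subgroup G} (h1 : H₁.index = 2) (h2 : H₂.index = 2)
    (hne : H₁ ≠ H₂) : ∃ a : G, a ∈ H₁ ∧ a ∉ H₂ :=
  Set.not_subset.1 (not_le_of_index_two_bc h1 h2 hne)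

omit [Fintype G] [DecidableEq G] in
/-- **`H₁ ⊓ H₂` has index `4`** for distinct subgroups `H₁, H₂` of index `2` (two distinct hyperplanes of the
`𝔽₂`-space `Gal(K/ℚ)` meet in codimension `2`). [cite: Dodson1984, §3.1.1 (the Galois group `(ℤ/2)^{r+1}` of `ℚ(√−d, √a₁, …, √a_r)`)] -/
theorem index_inf_eq_four [Finite G] {H₁ H₂ : Subgroup G} (h1 : H₁.index = 2) (h2 : H₂.index = 2)
    (hne : H₁ ≠ H₂) : (H₁ ⊓ H₂).index = 4 := by
  have hle4 : (H₁ ⊓ H₂).index ≤ 4 := by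
    have := Subgroup.index_inf_le (H := H₁) (K := H₂)
    rw [h1, h2] at this
    exact this
  have hrel := Subgroup.relIndex_mul_index (inf_le_left : H₁ ⊓ H₂ ≤ H₁)
  rw [h1] at hrel
  have hr1 : (H₁ ⊓ H₂).relIndex H₁ ≠ 1 := by
    intro hr
    have hle : H₁ ≤ H₁ ⊓ H₂ := Subgroup.relIndex_eq_one.1 hr
    exact not_le_of_index_two_bc h1 h2 hne (hle.trans inf_le_right)
  have hi0 : (H₁ ⊓ H₂).index ≠ 0 := Subgroup.index_ne_zero_of_finite
  have hr0 : (H₁ ⊓ H₂).relIndex H₁ ≠ 0 := fun h0 => hi0 (by rw [← hrel, h0, zero_mul])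
  omega

omit [Fintype G] [DecidableEq G] in
/-- For index-`2` subgroups `H₁ ≠ H₂` avoiding `ρ`, and `a ∈ H₁ ∖ H₂`, `b ∈ H₂ ∖ H₁`: `ρab ∈ H₁ ⊓ H₂` (i.e. `ρ` lies in
the fourth coset `abH`, so the third hyperplane `H ⊔ abH = {g : g ∈ H₁ ↔ g ∈ H₂}` contains `ρ`). [folklore] -/
private theorem rho_mul_mul_mem_inf_bc {H₁ H₂ : Subgroup G} (h1 : H₁.index = 2) (h2 : H₂.index = 2)
    (hρ1 : ρ ∉ H₁) (hρ2 : ρ ∉ H₂) {a b : G} (ha1 : a ∈ H₁) (ha2 : a ∉ H₂) (hb1 : b ∉ H₁) (hb2 : b ∈ H₂) :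
    ρ * a * b ∈ H₁ ⊓ H₂ := by
  refine Subgroup.mem_inf.2 ⟨?_, ?_⟩
  · have hρb : ρ * b ∈ H₁ := (Subgroup.mul_mem_iff_of_index_two h1).2 (iff_of_false hρ1 hb1)
    have : ρ * a * b = ρ * b * a := by rw [mul_assoc, mul_comm a, ← mul_assoc]
    rw [this]
    exact H₁.mul_mem hρb ha1
  · have hρa : ρ * a ∈ H₂ := (Subgroup.mul_mem_iff_of_index_two h2).2 (iff_of_false hρ2 ha2)
    exact H₂.mul_mem hρa hb2

omit [Fintype G] [DecidableEq G] in
/-- The case `a ∈ M`, `b ∉ M` of the trichotomy: then `M = H₁`. [folklore] -/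
private theorem eq_of_mem_of_not_mem_bc {H₁ H₂ M : Subgroup G} (h1 : H₁.index = 2) (h2 : H₂.index = 2)
    (hM : M.index = 2) (hle : H₁ ⊓ H₂ ≤ M) {a b : G} (ha1 : a ∈ H₁) (ha2 : a ∉ H₂) (hb1 : b ∉ H₁) (hb2 : b ∈ H₂)
    (haM : a ∈ M) (hbM : b ∉ M) : M = H₁ := by
  ext g
  by_cases hg1 : g ∈ H₁ <;> by_cases hg2 : g ∈ H₂
  · exact iff_of_true (hle (Subgroup.mem_inf.2 ⟨hg1, hg2⟩)) hg1
  · have hga : g * a ∈ H₁ ⊓ H₂ := Subgroup.mem_inf.2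
      ⟨H₁.mul_mem hg1 ha1, (Subgroup.mul_mem_iff_of_index_two h2).2 (iff_of_false hg2 ha2)⟩
    exact iff_of_true (((Subgroup.mul_mem_iff_of_index_two hM).1 (hle hga)).2 haM) hg1
  · have hgb : g * b ∈ H₁ ⊓ H₂ := Subgroup.mem_inf.2
      ⟨(Subgroup.mul_mem_iff_of_index_two h1).2 (iff_of_false hg1 hb1), H₂.mul_mem hg2 hb2⟩
    exact iff_of_false (fun hgM => hbM (((Subgroup.mul_mem_iff_of_index_two hM).1 (hle hgb)).1 hgM)) hg1
  · have hab1 : a * b ∉ H₁ := fun h => hb1 (((Subgroup.mul_mem_iff_of_index_two h1).1 h).1 ha1)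
    have hab2 : a * b ∉ H₂ := fun h => ha2 (((Subgroup.mul_mem_iff_of_index_two h2).1 h).2 hb2)
    have habM : a * b ∉ M := fun h => hbM (((Subgroup.mul_mem_iff_of_index_two hM).1 h).1 haM)
    have hgab : g * (a * b) ∈ H₁ ⊓ H₂ := Subgroup.mem_inf.2
      ⟨(Subgroup.mul_mem_iff_of_index_two h1).2 (iff_of_false hg1 hab1),
        (Subgroup.mul_mem_iff_of_index_two h2).2 (iff_of_false hg2 hab2)⟩
    exact iff_of_false (fun hgM => habM (((Subgroup.mul_mem_iff_of_index_two hM).1 (hle hgab)).1 hgM)) hg1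

omit [Fintype G] [DecidableEq G] in
/-- **TRICHOTOMY.**  For index-`2` subgroups `H₁ ≠ H₂` avoiding `ρ`, an index-`2` subgroup `M ⊇ H₁ ⊓ H₂` avoiding `ρ` is
`H₁` or `H₂`: of the three hyperplanes through `H₁ ⊓ H₂` the third contains `ρ`.  (Field side: a biquadratic CM subfield
`F₁F₂` of a multiquadratic CM field has exactly the two imaginary quadratic subfields `F₁`, `F₂`; its third quadratic
subfield is real.) [cite: Dodson1984, §3.1.1] -/
theorem eq_or_eq_of_inf_le [Finite G] {H₁ H₂ M : Subgroup G} (h1 : H₁.index = 2) (h2 : H₂.index = 2)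
    (hne : H₁ ≠ H₂) (hρ1 : ρ ∉ H₁) (hρ2 : ρ ∉ H₂) (hM : M.index = 2) (hle : H₁ ⊓ H₂ ≤ M) (hρM : ρ ∉ M) :
    M = H₁ ∨ M = H₂ := by
  obtain ⟨a, ha1, ha2⟩ := exists_mem_not_mem_bc h1 h2 hne
  obtain ⟨b, hb2, hb1⟩ := exists_mem_not_mem_bc h2 h1 hne.symm
  have hρab : ρ * a * b ∈ M := hle (rho_mul_mul_mem_inf_bc h1 h2 hρ1 hρ2 ha1 ha2 hb1 hb2)
  by_cases haM : a ∈ M <;> by_cases hbM : b ∈ M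
  · exfalso
    have h3 : ρ * (a * b) ∈ M := by rwa [← mul_assoc]
    exact hρM (((Subgroup.mul_mem_iff_of_index_two hM).1 h3).2 (M.mul_mem haM hbM))
  · exact Or.inl (eq_of_mem_of_not_mem_bc h1 h2 hM hle ha1 ha2 hb1 hb2 haM hbM)
  · exact Or.inr (eq_of_mem_of_not_mem_bc h2 h1 hM (by rwa [inf_comm]) hb2 hb1 ha2 ha1 hbM haM)
  · exfalso
    have habM : a * b ∈ M := (Subgroup.mul_mem_iff_of_index_two hM).2 (iff_of_false haM hbM)
    have h3 : ρ * (a * b) ∈ M := by rwa [← mul_assoc]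
    exact hρM (((Subgroup.mul_mem_iff_of_index_two hM).1 h3).2 habM)

omit [DecidableEq G] in
/-- **EVERY INDEX-`4` SUBGROUP AVOIDING `ρ` IS `H₁ ⊓ H₂` FOR TWO DISTINCT HYPERPLANES AVOIDING `ρ`** (exponent `2`:
`H₁ = H ⊔ aH`, `H₂ = H ⊔ ρaH` for any `a ∉ H ⊔ ρH`; field side: a biquadratic CM subfield of `ℚ(√−d, √a₁, …, √a_r)` is
the compositum of its two imaginary quadratic subfields). [cite: Dodson1984, §3.1.1 (the Galois group `(ℤ/2)^{r+1}` of `ℚ(√−d, √a₁, …, √a_r)`)] -/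
theorem exists_eq_inf_of_index_eq_four (hexp : ∀ g : G, g ^ 2 = 1) {H : Subgroup G} (hH : H.index = 4)
    (hρ : ρ ∉ H) :
    ∃ H₁ H₂ : Subgroup G, H₁.index = 2 ∧ H₂.index = 2 ∧ H₁ ≠ H₂ ∧ ρ ∉ H₁ ∧ ρ ∉ H₂ ∧ H₁ ⊓ H₂ = H := by
  have hcard : Nat.card H * 4 = Nat.card G := by rw [← hH]; exact H.card_mul_index
  -- an element outside `H ⊔ ⟨ρ⟩`
  have hHρ : Nat.card ↥(H ⊔ Subgroup.zpowers ρ) = 2 * Nat.card H := natCard_sup_zpowers hexp H hρ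
  obtain ⟨a, ha⟩ : ∃ a : G, a ∉ H ⊔ Subgroup.zpowers ρ := by
    by_contra hall
    push Not at hall
    have htop : H ⊔ Subgroup.zpowers ρ = ⊤ := (Subgroup.eq_top_iff' _).2 hall
    have := hHρ
    rw [htop, Subgroup.card_top] at this
    have hpos : 0 < Nat.card H := Nat.card_pos
    omega
  rw [mem_sup_zpowers_iff_of_sq_eq_one hexp] at ha
  push Not at ha
  obtain ⟨haH, hρa⟩ := ha
  have hρa' : ρ * a ∉ H := hρa
  have haρ : a * ρ ∉ H := by rwa [mul_comm]
  refine ⟨H ⊔ Subgroup.zpowers a, H ⊔ Subgroup.zpowers (ρ * a), ?_, ?_, ?_, ?_, ?_, ?_⟩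
  · have h1 := (H ⊔ Subgroup.zpowers a).card_mul_index
    rw [natCard_sup_zpowers hexp H haH, ← hcard] at h1
    have hpos : 0 < Nat.card H := Nat.card_pos
    nlinarith [h1]
  · have h1 := (H ⊔ Subgroup.zpowers (ρ * a)).card_mul_index
    rw [natCard_sup_zpowers hexp H hρa', ← hcard] at h1
    have hpos : 0 < Nat.card H := Nat.card_pos
    nlinarith [h1]
  · intro heq
    have haA : a ∈ H ⊔ Subgroup.zpowers a := Subgroup.mem_sup_right (Subgroup.mem_zpowers a)
    rw [heq, mem_sup_zpowers_iff_of_sq_eq_one hexp] at haA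
    rcases haA with h | h
    · exact haH h
    · rw [mul_assoc, mul_self_bc hexp, mul_one] at h
      exact hρ h
  · exact rho_not_mem_sup_zpowers hexp H hρ haρ
  · refine rho_not_mem_sup_zpowers hexp H hρ ?_
    rw [mul_assoc, mul_comm a, ← mul_assoc, mul_self_bc hexp, one_mul]
    exact haH
  · refine le_antisymm ?_ (le_inf le_sup_left le_sup_left)
    intro g hg
    rw [Subgroup.mem_inf, mem_sup_zpowers_iff_of_sq_eq_one hexp, mem_sup_zpowers_iff_of_sq_eq_one hexp] at hg
    rcases hg with ⟨hg1 | hg1, hg2 | hg2⟩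
    · exact hg1
    · exact hg1
    · exact hg2
    · exfalso
      apply hρ
      have : ρ = ρ * a * g * (a * g)⁻¹ := by rw [mul_assoc ρ, mul_inv_cancel_right]
      rw [this]
      exact H.mul_mem hg2 (H.inv_mem hg1)

/-- **THE COSETS OF `H₁ ⊓ H₂` ARE BALANCED IFF `H₁` AND `H₂` ARE BALANCED** (`H₁ ≠ H₂` of index `2` avoiding `ρ`).
Field side (multiquadratic CM field): a CM type is of Weil type over the biquadratic CM subfield `F₁F₂` iff it is of
Weil type over `F₁` and over `F₂` — the intersection of two Weil-type conditions of Yanai's kind `a = b`.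
[cite: MoonenZarhin1998WeilClasses, Criterion (Q1)] [cite: Gordon1999HodgeAVSurvey, 9.4.3] [cite: Dodson1984, §3.1.1] -/
theorem forall_coset_inf_iff (hexp : ∀ g : G, g ^ 2 = 1) (h : IsCMTypeWith ρ (T : Set G)) {H₁ H₂ : Subgroup G}
    (h1 : H₁.index = 2) (h2 : H₂.index = 2) (hne : H₁ ≠ H₂) (hρ1 : ρ ∉ H₁) (hρ2 : ρ ∉ H₂) :
    (∀ x : G, 2 * (T.filter fun t => x * t ∈ H₁ ⊓ H₂).card = Nat.card ↥(H₁ ⊓ H₂)) ↔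
      2 * (T.filter fun t => t ∈ H₁).card = Nat.card H₁ ∧ 2 * (T.filter fun t => t ∈ H₂).card = Nat.card H₂ := by
  have hρ : ρ ∉ H₁ ⊓ H₂ := fun h' => hρ1 (Subgroup.mem_inf.1 h').1
  rw [forall_coset_iff_forall_indexTwo hexp h (H₁ ⊓ H₂) hρ]
  constructor
  · intro hbal
    exact ⟨hbal H₁ inf_le_left hρ1 h1, hbal H₂ inf_le_right hρ2 h2⟩
  · rintro ⟨hb1, hb2⟩ M hle hρM hM
    rcases eq_or_eq_of_inf_le h1 h2 hne hρ1 hρ2 hM hle hρM with rfl | rfl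
    · exact hb1
    · exact hb2

/-- **THE COUNT: the index-`4` subgroups avoiding `ρ` with balanced cosets are in bijection with the PAIRS of balanced
hyperplanes avoiding `ρ`** — `#{H : [G:H] = 4, ρ ∉ H, cosets balanced} = C(w, 2)`, `w = #{H' : [G:H'] = 2, ρ ∉ H',
2·#(T ∩ H') = |H'|}` (`= |G|/2 + 1 − rank T`, Kubota–Dodson, tree).  Field side: a CM type of a multiquadratic CM field
of degree `2g` is of Weil type over exactly `C(g + 1 − Rank, 2)` biquadratic CM subfields. [cite: Kubota1965, §4 Lemma 2]
[cite: Dodson1984, §3.1.1 Theorem] [cite: MoonenZarhin1998WeilClasses, Criterion (Q1)] -/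
theorem ncard_indexFour_balanced_eq_choose (hexp : ∀ g : G, g ^ 2 = 1) (h : IsCMTypeWith ρ (T : Set G)) :
    {H : Subgroup G | H.index = 4 ∧ ρ ∉ H ∧
        ∀ x : G, 2 * (T.filter fun t => x * t ∈ H).card = Nat.card H}.ncard =
      Nat.choose {H' : Subgroup G | H'.index = 2 ∧ ρ ∉ H' ∧
        2 * (T.filter fun t => t ∈ H').card = Nat.card H'}.ncard 2 := by
  classical
  set W : Finset (Subgroup G) := Finset.univ.filter fun H' : Subgroup G => H'.index = 2 ∧ ρ ∉ H' ∧
    2 * (T.filter fun t => t ∈ H').card = Nat.card H' with hWdef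
  have hW : {H' : Subgroup G | H'.index = 2 ∧ ρ ∉ H' ∧ 2 * (T.filter fun t => t ∈ H').card = Nat.card H'}.ncard =
      W.card := by
    rw [← Set.ncard_coe_finset]
    congr 1
    ext H'
    simp only [hWdef, Set.mem_setOf_eq, Finset.coe_filter, Finset.mem_univ, true_and]
  rw [hW, ← Finset.card_powersetCard 2 W, ← Set.ncard_coe_finset]
  -- the map `{H₁, H₂} ↦ H₁ ⊓ H₂`
  set f : Finset (Subgroup G) → Subgroup G := fun s => s.inf id with hf
  have hmemW : ∀ {H' : Subgroup G}, H' ∈ W ↔ H'.index = 2 ∧ ρ ∉ H' ∧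
      2 * (T.filter fun t => t ∈ H').card = Nat.card H' := by
    intro H'
    simp only [hWdef, Finset.mem_filter, Finset.mem_univ, true_and]
  have hpair : ∀ s ∈ (W.powersetCard 2 : Set (Finset (Subgroup G))), ∃ H₁ H₂ : Subgroup G,
      H₁ ≠ H₂ ∧ s = {H₁, H₂} ∧ H₁ ∈ W ∧ H₂ ∈ W := by
    intro s hs
    rw [Finset.mem_coe, Finset.mem_powersetCard] at hs
    obtain ⟨H₁, H₂, hne, rfl⟩ := Finset.card_eq_two.1 hs.2
    exact ⟨H₁, H₂, hne, rfl, hs.1 (by simp), hs.1 (by simp)⟩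
  have hfpair : ∀ H₁ H₂ : Subgroup G, f {H₁, H₂} = H₁ ⊓ H₂ := by
    intro H₁ H₂
    simp only [hf, Finset.inf_insert, Finset.inf_singleton, id]
  have himage : f '' (W.powersetCard 2 : Set (Finset (Subgroup G))) =
      {H : Subgroup G | H.index = 4 ∧ ρ ∉ H ∧
        ∀ x : G, 2 * (T.filter fun t => x * t ∈ H).card = Nat.card H} := by
    ext H
    constructor
    · rintro ⟨s, hs, rfl⟩
      obtain ⟨H₁, H₂, hne, rfl, hH₁, hH₂⟩ := hpair s hs
      obtain ⟨h1, hρ1, hb1⟩ := hmemW.1 hH₁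
      obtain ⟨h2, hρ2, hb2⟩ := hmemW.1 hH₂
      rw [hfpair]
      exact ⟨index_inf_eq_four h1 h2 hne, fun h' => hρ1 (Subgroup.mem_inf.1 h').1,
        (forall_coset_inf_iff hexp h h1 h2 hne hρ1 hρ2).2 ⟨hb1, hb2⟩⟩
    · rintro ⟨hH, hρ, hbal⟩
      obtain ⟨H₁, H₂, h1, h2, hne, hρ1, hρ2, rfl⟩ := exists_eq_inf_of_index_eq_four hexp hH hρ
      obtain ⟨hb1, hb2⟩ := (forall_coset_inf_iff hexp h h1 h2 hne hρ1 hρ2).1 hbal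
      refine ⟨{H₁, H₂}, ?_, hfpair H₁ H₂⟩
      rw [Finset.mem_coe, Finset.mem_powersetCard]
      refine ⟨?_, Finset.card_pair hne⟩
      intro H' hH'
      rw [Finset.mem_insert, Finset.mem_singleton] at hH'
      rcases hH' with rfl | rfl
      · exact hmemW.2 ⟨h1, hρ1, hb1⟩
      · exact hmemW.2 ⟨h2, hρ2, hb2⟩
  have hinj : Set.InjOn f (W.powersetCard 2 : Set (Finset (Subgroup G))) := by
    intro s hs s' hs' hss'
    obtain ⟨H₁, H₂, hne, rfl, hH₁, hH₂⟩ := hpair s hs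
    obtain ⟨H₁', H₂', hne', rfl, hH₁', hH₂'⟩ := hpair s' hs'
    rw [hfpair, hfpair] at hss'
    obtain ⟨h1, hρ1, -⟩ := hmemW.1 hH₁
    obtain ⟨h2, hρ2, -⟩ := hmemW.1 hH₂
    obtain ⟨h1', hρ1', -⟩ := hmemW.1 hH₁'
    obtain ⟨h2', hρ2', -⟩ := hmemW.1 hH₂'
    have e1 := eq_or_eq_of_inf_le h1 h2 hne hρ1 hρ2 h1' (hss' ▸ inf_le_left) hρ1'
    have e2 := eq_or_eq_of_inf_le h1 h2 hne hρ1 hρ2 h2' (hss' ▸ inf_le_right) hρ2'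
    rcases e1 with rfl | rfl <;> rcases e2 with rfl | rfl
    · exact absurd rfl hne'
    · rfl
    · exact Finset.pair_comm _ _
    · exact absurd rfl hne'
  rw [← himage, hinj.ncard_image]

end IndexFour

end BalancedCosets

end Literature.NumberTheory.ComplexMultiplication
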